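import Literature.Probability.LatticeModels.CableGFFLevelSets
import Literature.Probability.LatticeModels.DirichletGreenLimit
import Literature.Probability.LatticeModels.DiscreteGFFSetFlip
import Literature.Probability.LatticeModels.LatticeDirichletEnergy
import HarnessLib

/-!
# The canonical discrete free field of `ℤ^d`: innovations and finite-volume (Dirichlet) fields

Topic `Literature/Probability/LatticeModels`. Brick 4 of the proof of
`Literature.Probability.LatticeModels.Lupu2016_cableSignClustersBounded` (Lupu 2016, Prop. 5.5).
We work on the canonical space `ℤ^d → ℝ` with a probability measure `ν` under which the
coordinate process `coordProc d` is a discrete Gaussian free field in the sense of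
`IsDiscreteGFF` (`CableGFFLevelSets.lean`: Gaussian, centred, `E[φ_x φ_y] = G(x - y)`,
`G = latticeGreen / 2`), `d ≥ 3`. Contents (all proved):

* `IsDiscreteGFF.map_field` — any version `(Ω, P, g)` of the free field pushes forward to such a
  `ν = P ∘ (ω ↦ g(·,ω))⁻¹` (so results proved on the canonical space transfer back);
* `IsDiscreteGFF.isInnovationSite_coord` — the free field has the innovation property
  `E[ζ_u φ_w] = δ_{uw}/2d` at EVERY site (`-Δ G = δ`, `LatticeGreenPoisson.lean`), hence the
  one-site flip and Cameron–Martin identities of `DiscreteGFFSiteFlip.lean` apply to it;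
* `dirichletField Λ φ` — the **finite-volume field** `ψ^Λ_x = φ_x - ∑_{z ∈ ∂Λ} H_Λ(x,z) φ_z`
  (`x ∈ Λ`; `0` off `Λ`): `φ` minus the harmonic extension of its values on `∂Λ`, which is how
  Lupu's finite-volume free field "with instant killing at reaching `V_n ∖ V_{n-1}`" (proof of
  Prop. 4.2) sits inside the infinite-volume one. Under `ν` it is a centred Gaussian process
  with `E[ψ_x φ_w] = E[ψ_x ψ_w] = G_Λ(x,w)` (`dirichletGreen`, via Green's representation
  formula `ψ_x = 2d ∑_{y ∈ Λ} G_Λ(x,y) ζ_y`), it has the innovation property at every `u ∈ Λ`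
  (`IsDiscreteGFF.isInnovationSite_dirichletField`, so the set flips
  `lintegral_comp_setFlip` apply to it: all its "clusters" are finite), and
  `E[(φ_x - ψ^{Λ_n}_x)²] = G(0) - G_{Λ_n}(x,x) → 0` (`tendsto_integral_sub_dirichletField_sq`)
  — Lupu's "`ψ^{V_{n-1}}` converges in law to `ψ`", here in `L²` on one probability space.

References: T. Lupu, Ann. Probab. 44 (2016), §1 (the free field `E[φ_xφ_y] = G(x,y)`) and proof
of Prop. 4.2 [`Lupu2016`]; G. F. Lawler, *Intersections of Random Walks* (1991), §1.4–1.5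
[`Lawler1991`]. Classical statements are tagged `[folklore]`.
-/

noncomputable section

namespace Literature.Probability.LatticeModels

open _root_.MeasureTheory _root_.ProbabilityTheory Finset Filter _root_.Topology
open scoped ENNReal NNReal

variable {d : ℕ}

/-! ### The canonical coordinate process -/

variable (d) in
/-- The coordinate process `x ↦ (φ ↦ φ x)` on the canonical space `ℤ^d → ℝ`. [folklore] -/
abbrev coordProc : Site d → (Site d → ℝ) → ℝ := fun x φ => φ x

/-- `-Δ φ (y) = 2d ζ_y(φ)`: minus the Laplacian is `2d` times the innovation. [folklore] -/
theorem neg_latticeLaplacianZd_eq_innovation (φ : Site d → ℝ) (y : Site d) :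
    -latticeLaplacianZd φ y = 2 * d * siteInnovation φ y := by
  rw [latticeLaplacianZd_eq_sum_neighborFinset, Finset.sum_sub_distrib, Finset.sum_const,
    card_neighborFinset_zdGraph_holds, nsmul_eq_mul, siteInnovation, zdNeighborSum]
  rcases Nat.eq_zero_or_pos d with rfl | hd
  · simp
  · have : (2 * d : ℝ) ≠ 0 := by positivity
    push_cast
    field_simp
    ring

namespace IsDiscreteGFF

/-! ### Transfer to the canonical space -/

/-- **Any version of the free field pushes forward to the canonical space**: if `g` is a discrete
GFF under `P`, the law of `ω ↦ g(·, ω)` makes the coordinate process a discrete GFF. [folklore] -/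
theorem map_field {Ω : Type*} [MeasurableSpace Ω] {P : Measure Ω} {g : Site d → Ω → ℝ}
    (hg : IsDiscreteGFF P g) :
    IsDiscreteGFF (P.map fun ω x => g x ω) (coordProc d) := by
  have hP := hg.1.isProbabilityMeasure
  have hG : AEMeasurable (fun ω x => g x ω) P := aemeasurable_pi_lambda _ fun x => hg.1.aemeasurable x
  refine ⟨⟨fun I => ⟨?_⟩⟩, fun x => ?_, fun x y => ?_⟩
  · rw [AEMeasurable.map_map_of_aemeasurable (Measurable.aemeasurable (by fun_prop)) hG]
    exact (hg.1.hasGaussianLaw I).isGaussian_map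
  · rw [integral_map hG (Measurable.aestronglyMeasurable (by fun_prop))]
    exact hg.2.1 x
  · rw [integral_map hG (Measurable.aestronglyMeasurable (by fun_prop))]
    exact hg.2.2 x y

/-! ### The innovation property of the free field at every site -/

variable {ν : Measure (Site d → ℝ)}

/-- The coordinates are square integrable. [folklore] -/
theorem memLp_coord (hν : IsDiscreteGFF ν (coordProc d)) (x : Site d) :
    MemLp (fun φ : Site d → ℝ => φ x) 2 ν :=
  (hν.1.hasGaussianLaw_eval x).memLp_two

/-- Products of coordinates are integrable. [folklore] -/
theorem integrable_coord_mul (hν : IsDiscreteGFF ν (coordProc d)) (x y : Site d) :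
    Integrable (fun φ : Site d → ℝ => φ x * φ y) ν :=
  (hν.memLp_coord x).integrable_mul (hν.memLp_coord y)

variable (d) in
/-- `2d G(u - w) - ∑_{v ∼ u} G(v - w) = [u = w]` for `G = latticeGreen / 2`, `d ≥ 3`: the
Green function solves `-Δ G(· - w) = δ_w`. [cite: Lawler1991, §1.5, p. 29] -/
theorem two_mul_halfGreen_sub_sum (hd : 3 ≤ d) (u w : Site d) :
    2 * d * (latticeGreen (u - w) / 2) -
      ∑ v ∈ (zdGraph d).neighborFinset u, latticeGreen (v - w) / 2 = if u = w then 1 else 0 := by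
  have h := neg_latticeLaplacianZd_half_latticeGreen_sub d hd w u
  rw [latticeLaplacianZd_eq_sum_neighborFinset, Finset.sum_sub_distrib, Finset.sum_const,
    card_neighborFinset_zdGraph_holds, nsmul_eq_mul] at h
  push_cast at h
  linarith

/-- **The free field of `ℤ^d` has the innovation property at every site** (`d ≥ 3`):
`E[ζ_u φ_w] = G(u-w) - (2d)⁻¹ ∑_{v∼u} G(v-w) = δ_{uw}/2d`. [folklore] -/
theorem isInnovationSite_coord (hν : IsDiscreteGFF ν (coordProc d)) (hd : 3 ≤ d) (u : Site d) :
    IsInnovationSite ν (coordProc d) u where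
  isGaussianProcess := hν.1
  measurable x := measurable_pi_apply x
  integral_eq_zero := hν.2.1
  integral_innovation_mul w := by
    have hint := hν.integrable_coord_mul
    have hexp : ∀ φ : Site d → ℝ, siteInnovation (coordProc d · φ) u * φ w =
        φ u * φ w - (2 * d : ℝ)⁻¹ * ∑ v ∈ (zdGraph d).neighborFinset u, φ v * φ w := by
      intro φ
      simp only [coordProc, siteInnovation, zdNeighborSum]
      rw [sub_mul, mul_assoc, Finset.sum_mul]
    simp_rw [hexp]
    rw [integral_sub (hint u w) ((integrable_finsetSum _ fun v _ => hint v w).const_mul _),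
      integral_const_mul, integral_finsetSum _ fun v _ => hint v w, hν.2.2]
    simp_rw [hν.2.2]
    have key := two_mul_halfGreen_sub_sum d hd u w
    have h2d : (2 * d : ℝ) ≠ 0 := by positivity
    by_cases huw : u = w
    · subst huw
      rw [if_pos rfl] at key ⊢
      field_simp
      linarith
    · rw [if_neg huw] at key
      rw [if_neg (Ne.symm huw)]
      field_simp
      linarith

end IsDiscreteGFF

/-! ### The finite-volume (Dirichlet) field inside the infinite-volume one -/

/-- The **finite-volume (Dirichlet) field** of the finite set `Λ` read off a configuration `φ`
of `ℤ^d`: `ψ^Λ_x = φ_x - ∑_{z ∈ ∂Λ} H_Λ(x,z) φ_z` for `x ∈ Λ` (`φ` minus the harmonic extension of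
its boundary values) and `0` off `Λ`. Under the free field this is the free field of `Λ` with
Dirichlet (killing) boundary condition, of covariance `G_Λ` (Lupu 2016, proof of Prop. 4.2, the
fields `ψ^{V_{n-1}}`). [cite: Lupu2016, proof of Prop. 4.2] -/
def dirichletField (Λ : Finset (Site d)) (φ : Site d → ℝ) : Site d → ℝ :=
  fun x => if x ∈ Λ then φ x - ∑ z ∈ outerBoundary (zdGraph d) Λ, poissonKernel Λ x z * φ z else 0

/-- `ψ^Λ` on `Λ`. [folklore] -/
theorem dirichletField_of_mem {Λ : Finset (Site d)} (φ : Site d → ℝ) {x : Site d} (hx : x ∈ Λ) :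
    dirichletField Λ φ x = φ x - ∑ z ∈ outerBoundary (zdGraph d) Λ, poissonKernel Λ x z * φ z := by
  simp only [dirichletField, hx, if_true]

/-- `ψ^Λ` vanishes off `Λ`. [folklore] -/
theorem dirichletField_of_not_mem {Λ : Finset (Site d)} (φ : Site d → ℝ) {x : Site d}
    (hx : x ∉ Λ) : dirichletField Λ φ x = 0 := by
  simp only [dirichletField, hx, if_false]

/-- **`ψ^Λ_x = ∑_{y ∈ Λ} G_Λ(x,y) · 2d ζ_y(φ)`** (`d ≥ 1`): by Green's representation formula the
finite-volume field is the Dirichlet Green potential of the innovations. [folklore] -/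
theorem dirichletField_eq_sum_innovation (hd : 0 < d) (Λ : Finset (Site d)) (φ : Site d → ℝ)
    (x : Site d) :
    dirichletField Λ φ x = ∑ y ∈ Λ, dirichletGreen Λ x y * (2 * d * siteInnovation φ y) := by
  by_cases hx : x ∈ Λ
  · have h := green_representation hd Λ φ hx
    simp_rw [neg_latticeLaplacianZd_eq_innovation] at h
    rw [dirichletField_of_mem φ hx]
    linarith
  · rw [dirichletField_of_not_mem φ hx]
    exact (Finset.sum_eq_zero fun y _ => by rw [dirichletGreen_of_not_mem_left Λ hx y, zero_mul]).symm

/-- Each coordinate of `ψ^Λ` is measurable in `φ`. [folklore] -/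
theorem measurable_dirichletField (Λ : Finset (Site d)) (x : Site d) :
    Measurable fun φ : Site d → ℝ => dirichletField Λ φ x := by
  by_cases hx : x ∈ Λ
  · simp only [dirichletField, hx, if_true]
    exact (measurable_pi_apply x).sub
      (Finset.measurable_sum _ fun z _ => measurable_const.mul (measurable_pi_apply z))
  · simp only [dirichletField, hx, if_false]
    exact measurable_const

namespace IsDiscreteGFF

variable {ν : Measure (Site d → ℝ)}

/-- `ψ^Λ` is a Gaussian process under the free field (each coordinate is a finite linear
combination of coordinates of `φ`). [folklore] -/
theorem isGaussianProcess_dirichletField (hν : IsDiscreteGFF ν (coordProc d)) (Λ : Finset (Site d)) :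
    IsGaussianProcess (fun x (φ : Site d → ℝ) => dirichletField Λ φ x) ν := by
  classical
  refine hν.1.of_isGaussianProcess fun x => ?_
  by_cases hx : x ∈ Λ
  · set I : Finset (Site d) := insert x (outerBoundary (zdGraph d) Λ) with hI
    refine ⟨I, ContinuousLinearMap.proj (R := ℝ) (⟨x, Finset.mem_insert_self _ _⟩ : I) -
      ∑ z ∈ (outerBoundary (zdGraph d) Λ).attach, poissonKernel Λ x z •
        ContinuousLinearMap.proj (R := ℝ) (⟨z.1, Finset.mem_insert_of_mem z.2⟩ : I), fun φ => ?_⟩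
    simp only [dirichletField_of_mem φ hx, coordProc, FunLike.coe_sub, FunLike.coe_sum,
      FunLike.coe_smul, Pi.sub_apply, Finset.sum_apply, Pi.smul_apply,
      ContinuousLinearMap.proj_apply, Finset.restrict_def, smul_eq_mul]
    congr 1
    exact (Finset.sum_attach (outerBoundary (zdGraph d) Λ) fun z => poissonKernel Λ x z * φ z).symm
  · refine ⟨∅, 0, fun φ => ?_⟩
    simp [dirichletField_of_not_mem φ hx]

/-- `ψ^Λ` is centred. [folklore] -/
theorem integral_dirichletField (hν : IsDiscreteGFF ν (coordProc d)) (Λ : Finset (Site d))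
    (x : Site d) : ∫ φ, dirichletField Λ φ x ∂ν = 0 := by
  have hint : ∀ z, Integrable (fun φ : Site d → ℝ => φ z) ν := fun z =>
    (hν.1.hasGaussianLaw_eval z).integrable
  by_cases hx : x ∈ Λ
  · simp_rw [dirichletField_of_mem _ hx]
    rw [integral_sub (hint x) (integrable_finsetSum _ fun z _ => (hint z).const_mul _),
      integral_finsetSum _ fun z _ => (hint z).const_mul _]
    simp_rw [integral_const_mul]
    simp [hν.2.1]
  · simp_rw [dirichletField_of_not_mem _ hx]
    exact integral_zero _ _

/-- **`E[ψ^Λ_x φ_w] = G_Λ(x,w)`** (`d ≥ 3`; both sides vanish unless `x, w ∈ Λ`): from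
`ψ_x = 2d ∑_y G_Λ(x,y) ζ_y` and the innovation property `E[ζ_y φ_w] = δ_{yw}/2d`.
[folklore] -/
theorem integral_dirichletField_mul_coord (hν : IsDiscreteGFF ν (coordProc d)) (hd : 3 ≤ d)
    (Λ : Finset (Site d)) (x w : Site d) :
    ∫ φ, dirichletField Λ φ x * φ w ∂ν = dirichletGreen Λ x w := by
  classical
  have hd0 : 0 < d := by omega
  have hinn : ∀ y, Integrable (fun φ : Site d → ℝ => siteInnovation (coordProc d · φ) y * φ w) ν :=
    fun y => (hν.isInnovationSite_coord hd y).hasGaussianLaw_innovation.memLp_two.integrable_mul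
      (hν.memLp_coord w)
  have hexp : ∀ φ : Site d → ℝ, dirichletField Λ φ x * φ w =
      ∑ y ∈ Λ, (dirichletGreen Λ x y * (2 * d)) * (siteInnovation (coordProc d · φ) y * φ w) := by
    intro φ
    rw [dirichletField_eq_sum_innovation hd0, Finset.sum_mul]
    exact Finset.sum_congr rfl fun y _ => by simp only [coordProc]; ring
  simp_rw [hexp]
  rw [integral_finsetSum _ fun y _ => (hinn y).const_mul _]
  simp_rw [integral_const_mul, (hν.isInnovationSite_coord hd _).integral_innovation_mul w]
  have h2d : (2 * d : ℝ) ≠ 0 := by positivity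
  simp only [mul_ite, mul_zero]
  rw [Finset.sum_ite_eq]
  by_cases hw : w ∈ Λ
  · rw [if_pos hw, mul_inv_cancel_right₀ h2d]
  · rw [if_neg hw, dirichletGreen_of_not_mem_right Λ x hw]

/-- **`E[ψ^Λ_x ψ^Λ_y] = G_Λ(x,y)`** (`d ≥ 3`): the finite-volume field has the Dirichlet Green
function as covariance (the boundary terms drop out since `G_Λ(x, ·)` vanishes on `∂Λ`).
[cite: Lupu2016, proof of Prop. 4.2] -/
theorem integral_dirichletField_mul (hν : IsDiscreteGFF ν (coordProc d)) (hd : 3 ≤ d)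
    (Λ : Finset (Site d)) (x y : Site d) :
    ∫ φ, dirichletField Λ φ x * dirichletField Λ φ y ∂ν = dirichletGreen Λ x y := by
  have hψφ : ∀ w, Integrable (fun φ : Site d → ℝ => dirichletField Λ φ x * φ w) ν := fun w =>
    ((hν.isGaussianProcess_dirichletField Λ).hasGaussianLaw_eval x).memLp_two.integrable_mul
      (hν.memLp_coord w)
  by_cases hy : y ∈ Λ
  · have hexp : ∀ φ : Site d → ℝ, dirichletField Λ φ x * dirichletField Λ φ y =
        dirichletField Λ φ x * φ y - ∑ z ∈ outerBoundary (zdGraph d) Λ,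
          poissonKernel Λ y z * (dirichletField Λ φ x * φ z) := by
      intro φ
      rw [dirichletField_of_mem φ hy, mul_sub, Finset.mul_sum]
      exact congrArg₂ _ rfl (Finset.sum_congr rfl fun z _ => by ring)
    simp_rw [hexp]
    rw [integral_sub (hψφ y) (integrable_finsetSum _ fun z _ => (hψφ z).const_mul _),
      integral_finsetSum _ fun z _ => (hψφ z).const_mul _]
    simp_rw [integral_const_mul, hν.integral_dirichletField_mul_coord hd]
    have hzero : ∑ z ∈ outerBoundary (zdGraph d) Λ, poissonKernel Λ y z * dirichletGreen Λ x z = 0 :=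
      Finset.sum_eq_zero fun z hz => by
        rw [dirichletGreen_of_not_mem_right Λ x (mem_outerBoundary_iff.1 hz).1, mul_zero]
    rw [hzero, sub_zero]
  · simp_rw [dirichletField_of_not_mem _ hy, mul_zero]
    rw [integral_zero, dirichletGreen_of_not_mem_right Λ x hy]

/-- **The finite-volume field has the innovation property at every `u ∈ Λ`** (`d ≥ 3`):
`E[ζ_u(ψ) ψ_w] = G_Λ(u,w) - (2d)⁻¹ ∑_{v∼u} G_Λ(v,w) = δ_{uw}/2d`, the Poisson equation for `G_Λ`.
Consequently the set flips `lintegral_comp_setFlip` apply to `ψ^Λ` on every `S ⊆ Λ`. [folklore] -/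
theorem isInnovationSite_dirichletField (hν : IsDiscreteGFF ν (coordProc d)) (hd : 3 ≤ d)
    {Λ : Finset (Site d)} {u : Site d} (hu : u ∈ Λ) :
    IsInnovationSite ν (fun x (φ : Site d → ℝ) => dirichletField Λ φ x) u where
  isGaussianProcess := hν.isGaussianProcess_dirichletField Λ
  measurable := measurable_dirichletField Λ
  integral_eq_zero := hν.integral_dirichletField Λ
  integral_innovation_mul w := by
    have hd0 : 0 < d := by omega
    have hint : ∀ x y, Integrable
        (fun φ : Site d → ℝ => dirichletField Λ φ x * dirichletField Λ φ y) ν := fun x y =>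
      ((hν.isGaussianProcess_dirichletField Λ).hasGaussianLaw_eval x).memLp_two.integrable_mul
        ((hν.isGaussianProcess_dirichletField Λ).hasGaussianLaw_eval y).memLp_two
    have hexp : ∀ φ : Site d → ℝ,
        siteInnovation (fun x => dirichletField Λ φ x) u * dirichletField Λ φ w =
        dirichletField Λ φ u * dirichletField Λ φ w - (2 * d : ℝ)⁻¹ *
          ∑ v ∈ (zdGraph d).neighborFinset u, dirichletField Λ φ v * dirichletField Λ φ w := by
      intro φ
      simp only [siteInnovation, zdNeighborSum]
      rw [sub_mul, mul_assoc, Finset.sum_mul]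
    simp_rw [hexp]
    rw [integral_sub (hint u w) ((integrable_finsetSum _ fun v _ => hint v w).const_mul _),
      integral_const_mul, integral_finsetSum _ fun v _ => hint v w]
    simp_rw [hν.integral_dirichletField_mul hd]
    -- the Poisson equation for `G_Λ(w, ·)` at `u ∈ Λ`
    have key := sum_neighborFinset_dirichletGreen hd0 Λ w hu
    simp_rw [dirichletGreen_comm Λ _ w]
    rw [key]
    have h2d : (2 * d : ℝ) ≠ 0 := by positivity
    split_ifs <;> field_simp <;> ring

/-- **`E[(φ_x - ψ^Λ_x)²] = G(0) - G_Λ(x,x)`** (`d ≥ 3`), the variance of the harmonic extension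
of the boundary values. [folklore] -/
theorem integral_sub_dirichletField_sq (hν : IsDiscreteGFF ν (coordProc d)) (hd : 3 ≤ d)
    (Λ : Finset (Site d)) (x : Site d) :
    ∫ φ, (φ x - dirichletField Λ φ x) ^ 2 ∂ν = latticeGreen (0 : Site d) / 2 - dirichletGreen Λ x x := by
  have h1 := hν.integrable_coord_mul x x
  have h2 : Integrable (fun φ : Site d → ℝ => dirichletField Λ φ x * φ x) ν :=
    ((hν.isGaussianProcess_dirichletField Λ).hasGaussianLaw_eval x).memLp_two.integrable_mul
      (hν.memLp_coord x)
  have h3 : Integrable (fun φ : Site d → ℝ => dirichletField Λ φ x * dirichletField Λ φ x) ν :=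
    ((hν.isGaussianProcess_dirichletField Λ).hasGaussianLaw_eval x).memLp_two.integrable_mul
      ((hν.isGaussianProcess_dirichletField Λ).hasGaussianLaw_eval x).memLp_two
  have hexp : ∀ φ : Site d → ℝ, (φ x - dirichletField Λ φ x) ^ 2 =
      φ x * φ x - 2 * (dirichletField Λ φ x * φ x) + dirichletField Λ φ x * dirichletField Λ φ x := by
    intro φ; ring
  have h12 : Integrable (fun φ : Site d → ℝ =>
      φ x * φ x - 2 * (dirichletField Λ φ x * φ x)) ν := h1.sub (h2.const_mul 2)
  simp_rw [hexp]
  rw [integral_add h12 h3, integral_sub h1 (h2.const_mul 2),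
    integral_const_mul, hν.2.2, hν.integral_dirichletField_mul_coord hd,
    hν.integral_dirichletField_mul hd, sub_self x]
  ring

/-- **`ψ^{Λ_n}_x → φ_x` in `L²`** along the boxes `Λ_n` (`d ≥ 3`): `E[(φ_x - ψ^{Λ_n}_x)²] =
G(0) - G_{Λ_n}(x,x) → 0` (`tendsto_dirichletGreen_box`). This is the convergence of the
finite-volume free fields to the free field of `ℤ^d` invoked at the end of the proof of
Lupu 2016, Prop. 4.2, realised on one probability space. [cite: Lupu2016, proof of Prop. 4.2] -/
theorem tendsto_integral_sub_dirichletField_sq (hν : IsDiscreteGFF ν (coordProc d)) (hd : 3 ≤ d)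
    (x : Site d) :
    Tendsto (fun n : ℕ => ∫ φ, (φ x - dirichletField (box d n) φ x) ^ 2 ∂ν) atTop (𝓝 0) := by
  simp_rw [hν.integral_sub_dirichletField_sq hd]
  have h := (tendsto_dirichletGreen_box d hd x x).const_sub (latticeGreen (0 : Site d) / 2)
  rwa [sub_self x, sub_self] at h

end IsDiscreteGFF

end Literature.Probability.LatticeModels
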